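import Literature.Computability.AlgebraicComplexity.QuadraticSeparation
import HarnessLib

/-!
# Fiduccia–Zalcstein: `L(D) ≥ 2 dim D − 1` for a division algebra `D` (BCS 1997, Prop. (17.7))

Topic `Literature/Computability/AlgebraicComplexity`. Source: P. Bürgisser, M. Clausen, M. A. Shokrollahi,
*Algebraic Complexity Theory* (Springer 1997), Ch. 17, §17.1 [BurgisserClausenShokrollahi1997], verbatim:

* **(17.7) Proposition (Fiduccia and Zalcstein).** "For a division algebra `D` of dimension `n` over `k`
  we have `L(D) ≥ 2n − 1`."  Here `L(D)` is the multiplicative complexity (length of a shortest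
  quadratic computation, Def. (14.2)(2)/(14.7)) of the multiplication map `D × D → D`, a bilinear map
  over `k` ("Unless otherwise specified, `k` denotes any field", p. 455).
* Printed proof (p. 457): take an `(n−1)`-dimensional `T ⊆ D`; by the separation lemma (17.4)
  `f_1, …, f_{n−1}` separate the points of `T × 0`; with `π` the projection onto `⋂ ker fᵢ` along
  `T × 0` "it suffices to show that `μ ∘ π` is `2`-concise", and then `n ≤ L(μ ∘ π) ≤ ℓ − (n − 1)`.

## What is here (everything PROVED; no named facts — D-0026)

* `QuadComp.ofBasis` — the trivial quadratic computation of a bilinear map from bases of `U` and `V`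
  (length `dim U · dim V`), whence `QuadComp.mulComplexity_le_finrank_mul : L(φ) ≤ dim U · dim V` and
  the attainment of `mulComplexity` for finite-dimensional `U, V`;
* `QuadComp.card_ge_divisionAlgebra` — every quadratic computation of the multiplication of a
  finite-dimensional division algebra `D` over a field `k` has length `≥ 2 dim_k D − 1`;
* `fiducciaZalcstein_le_mulComplexity : 2 · finrank k D − 1 ≤ L(D)` — (17.7) as printed, with
  `L(D) = mulComplexity (LinearMap.mul k D)`; `BilinComp.card_ge_divisionAlgebra` — (17.1)
  `R(D) ≥ 2n − 1` for every bilinear computation (via `L ≤ R`).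

PROOF ROUTE (ours, shorter than the printed one and bilinear throughout — the printed route applies
(17.4)/(17.5) to the merely quadratic map `μ ∘ π`, for which the lemma's "in particular" clause is not
available in the tree, see `QuadraticSeparation.lean`). Let `(f_i, g_i, w_i)_{i ∈ ι}` compute `μ`. By
`1`-conciseness (`a · 1 = a`) and (17.5), `|ι| ≥ n`, so we may pick `S' ⊆ ι` with `|S'| = n − 1`. The
span of `{w_s : s ∈ S'}` has dimension `≤ n − 1 < n`, so some nonzero linear form `z₀ ∈ D*` kills it.
Then `z₀ ∘ μ : (a, b) ↦ z₀(ab)` is a BILINEAR form computed by `(f_i, g_i, z₀(w_i))_{i ∉ S'}` (length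
`|ι| − (n − 1)`), and it is `1`-concise: if `a ≠ 0` then `b ↦ ab` is onto `D` (`D` is a division ring),
so `z₀(a ·) ≠ 0`. By (17.5) for bilinear maps, `|ι| − (n − 1) ≥ n`. ∎

HONEST FRAMING. A classical 1977 lower bound, as printed in BCS; nothing new. `L` is the commutative
(quadratic) model; the statement is over an arbitrary field `k` and any division ring `D` that is a
finite-dimensional `k`-algebra (BCS's "division algebra of dimension `n` over `k`").

## References

* [BurgisserClausenShokrollahi1997] P. Bürgisser, M. Clausen, M. A. Shokrollahi, *Algebraic Complexity
  Theory*, Springer 1997, Prop. (17.7) (p. 457), Cor. (17.5), Def. (14.2)/(14.7); Fiduccia–Zalcstein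
  1977 (BCS ref. [163]).
-/

noncomputable section

open scoped BigOperators

namespace Literature.Computability.AlgebraicComplexity

open Module

variable {k : Type*} [Field k]

namespace QuadComp

section OfBasis

variable {U V W : Type*} [AddCommGroup U] [Module k U] [AddCommGroup V] [Module k V]
  [AddCommGroup W] [Module k W]
variable {φ : U →ₗ[k] V →ₗ[k] W}

/-- The trivial quadratic computation of a bilinear map from bases `(bᵢ)` of `U` and `(b'ⱼ)` of `V`:
`φ(u, v) = ∑_{i,j} bᵢ*(u) b'ⱼ*(v) φ(bᵢ, b'ⱼ)` (length `dim U · dim V`).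
[cite: BurgisserClausenShokrollahi1997, Def. (14.2)(2) and (14.7)] -/
def ofBasis {κ μ : Type*} [Fintype κ] [Fintype μ] (bU : Basis κ k U) (bV : Basis μ k V) :
    QuadComp φ (κ × μ) where
  f p := (bU.coord p.1).comp (LinearMap.fst k U V)
  g p := (bV.coord p.2).comp (LinearMap.snd k U V)
  w p := φ (bU p.1) (bV p.2)
  map_eq_sum u v := by
    have h1 : φ u v = ∑ i, ∑ j, (bU.repr u i * bV.repr v j) • φ (bU i) (bV j) := by
      conv_lhs => rw [← bU.sum_repr u, ← bV.sum_repr v]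
      simp only [map_sum, map_smul, LinearMap.sum_apply, LinearMap.smul_apply, Finset.smul_sum,
        mul_smul]
      rw [Finset.sum_comm]
      exact Finset.sum_congr rfl fun i _ => Finset.sum_congr rfl fun j _ => smul_comm _ _ _
    rw [h1, Fintype.sum_prod_type]
    rfl

/-- **`L(φ) ≤ dim U · dim V`** (the trivial computation). [cite: BurgisserClausenShokrollahi1997, Def. (14.7)] -/
theorem mulComplexity_le_finrank_mul [FiniteDimensional k U] [FiniteDimensional k V] :
    mulComplexity φ ≤ finrank k U * finrank k V := by
  simpa [Fintype.card_prod, Fintype.card_fin] using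
    mulComplexity_le_card (ofBasis (φ := φ) (Module.finBasis k U) (Module.finBasis k V))

/-- For finite-dimensional `U, V` the infimum `L(φ)` is attained.
[cite: BurgisserClausenShokrollahi1997, Def. (14.7)] -/
theorem nonempty_quadComp_fin_mulComplexity [FiniteDimensional k U] [FiniteDimensional k V] :
    Nonempty (QuadComp φ (Fin (mulComplexity φ))) :=
  nonempty_quadComp_mulComplexity (ofBasis (φ := φ) (Module.finBasis k U) (Module.finBasis k V))

end OfBasis

section DivisionAlgebra

variable {D : Type*} [DivisionRing D] [Algebra k D]

/-- **(17.7) at the level of a single computation**: every quadratic computation of the multiplication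
of a finite-dimensional division algebra `D` over `k` has length `≥ 2 dim_k D − 1`.
[cite: BurgisserClausenShokrollahi1997, Prop. (17.7)] -/
theorem card_ge_divisionAlgebra [FiniteDimensional k D] {ι : Type*} [Fintype ι]
    (q : QuadComp (LinearMap.mul k D) ι) : 2 * finrank k D - 1 ≤ Fintype.card ι := by
  classical
  -- `μ` is `1`-concise: `a · 1 = a`.
  have hconc : ∀ a : D, (∀ b : D, LinearMap.mul k D a b = 0) → a = 0 := fun a h => by
    simpa using h 1
  have hn_le : finrank k D ≤ Fintype.card ι := q.finrank_le_card_left hconc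
  have hpos : 0 < finrank k D := finrank_pos
  -- choose `n − 1` products to kill
  obtain ⟨S', -, hS'⟩ := Finset.exists_subset_card_eq (s := (Finset.univ : Finset ι))
    (n := finrank k D - 1) (by rw [Finset.card_univ]; omega)
  -- a nonzero linear form vanishing on the span of the corresponding outputs
  let W₁ : Submodule k D := Submodule.span k ((S'.image q.w : Finset D) : Set D)
  have hW₁ : finrank k W₁ ≤ finrank k D - 1 :=
    (finrank_span_finset_le_card (R := k) (S'.image q.w)).trans (Finset.card_image_le.trans hS'.le)
  have hlt : W₁ < ⊤ := Submodule.lt_top_of_finrank_lt_finrank (by omega)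
  obtain ⟨z₀, hz₀, hz₀W⟩ := Submodule.exists_dual_map_eq_bot_of_lt_top hlt inferInstance
  have hzw : ∀ s ∈ S', z₀ (q.w s) = 0 := fun s hs => by
    have hmem : q.w s ∈ W₁ := Submodule.subset_span (Finset.mem_coe.2 (Finset.mem_image_of_mem q.w hs))
    have : z₀ (q.w s) ∈ W₁.map z₀ := Submodule.mem_map_of_mem hmem
    rw [hz₀W] at this
    simpa using this
  -- the bilinear form `(a, b) ↦ z₀ (a b)` and its computation by the surviving products
  let ψ : D →ₗ[k] D →ₗ[k] k := (LinearMap.mul k D).compr₂ z₀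
  let q' : QuadComp ψ ↥(S'ᶜ) :=
    { f := fun i => q.f i.1
      g := fun i => q.g i.1
      w := fun i => z₀ (q.w i.1)
      map_eq_sum := fun a b => by
        show z₀ (LinearMap.mul k D a b) = _
        rw [q.map_eq_sum a b, map_sum]
        simp_rw [map_smul]
        rw [← Finset.sum_add_sum_compl S', Finset.sum_eq_zero (s := S')
          (fun i hi => by rw [hzw i hi, smul_zero]), zero_add]
        exact (Finset.sum_coe_sort (S'ᶜ) (fun i => (q.f i (a, b) * q.g i (a, b)) • z₀ (q.w i))).symm }
  -- `ψ` is `1`-concise because `D` is a division ring and `z₀ ≠ 0`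
  have hψ : ∀ a : D, (∀ b : D, ψ a b = 0) → a = 0 := by
    intro a ha
    by_contra hne
    obtain ⟨d, hd⟩ := DFunLike.ne_iff.1 hz₀
    have hd' : z₀ d ≠ 0 := by simpa using hd
    have := ha (a⁻¹ * d)
    simp only [ψ, LinearMap.compr₂_apply, LinearMap.mul_apply', ← mul_assoc, mul_inv_cancel₀ hne,
      one_mul] at this
    exact hd' this
  have h2 : finrank k D ≤ Fintype.card ↥(S'ᶜ) := q'.finrank_le_card_left hψ
  rw [Fintype.card_coe, Finset.card_compl] at h2
  omega

end DivisionAlgebra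

end QuadComp

/-- **BCS (17.1): `R(D) ≥ 2n − 1`** for a division algebra `D` of dimension `n` over `k`, at the level of
a single bilinear computation (a bilinear computation is a quadratic one, `BilinComp.toQuadComp`, so
this is (17.7) read through (14.8) `L ≤ R`; BCS prove (17.1) first, directly).
[cite: BurgisserClausenShokrollahi1997, Prop. (17.1)] -/
theorem BilinComp.card_ge_divisionAlgebra {D : Type*} [DivisionRing D] [Algebra k D]
    [FiniteDimensional k D] {ι : Type*} [Fintype ι] (β : BilinComp (LinearMap.mul k D) ι) :
    2 * finrank k D - 1 ≤ Fintype.card ι :=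
  β.toQuadComp.card_ge_divisionAlgebra

/-- **BCS (17.7) (Fiduccia–Zalcstein): `L(D) ≥ 2n − 1`** for a division algebra `D` of dimension `n`
over a field `k`, with `L(D) = mulComplexity (LinearMap.mul k D)` (quadratic computations of the
multiplication map). [cite: BurgisserClausenShokrollahi1997, Prop. (17.7)] -/
theorem fiducciaZalcstein_le_mulComplexity (k : Type*) [Field k] (D : Type*) [DivisionRing D]
    [Algebra k D] [FiniteDimensional k D] :
    2 * finrank k D - 1 ≤ mulComplexity (LinearMap.mul k D) := by
  obtain ⟨q⟩ := QuadComp.nonempty_quadComp_fin_mulComplexity (φ := LinearMap.mul k D)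
  simpa using q.card_ge_divisionAlgebra

/-- The window this leaves for a division algebra of dimension `n`: `2n − 1 ≤ L(D) ≤ n²`.
[cite: BurgisserClausenShokrollahi1997, Prop. (17.7) and Def. (14.7)] -/
theorem mulComplexity_divisionAlgebra_window (k : Type*) [Field k] (D : Type*) [DivisionRing D]
    [Algebra k D] [FiniteDimensional k D] :
    2 * finrank k D - 1 ≤ mulComplexity (LinearMap.mul k D) ∧
      mulComplexity (LinearMap.mul k D) ≤ finrank k D * finrank k D :=
  ⟨fiducciaZalcstein_le_mulComplexity k D, QuadComp.mulComplexity_le_finrank_mul⟩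

end Literature.Computability.AlgebraicComplexity
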